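import Literature.Computability.QuantumComplexity.OraclePolynomialMethod
import Mathlib.MeasureTheory.Integral.Bochner.Set
import HarnessLib

/-!
# Bounded independence fools bounded quantum queries (Zhandry 2012, Thm. 3.1)

Zhandry's bounded-independence lemma for the tree's oracle circuits
(`Cryptography/QuantumCircuit.lean`: `QCircuit G N` with XOR-query oracle gates on a language
`A ⊆ {0,1}*`, `QCircuit.acceptProb`, `QCircuitFamily.acceptProbOn`) and the tree's random oracle
`randomOracleMeasure` (`OracleSeparations.lean`, with the cylinder toolkit `restrictBool`,
`oracleCylinder`, `measure_oracleCylinder` of `RandomOracleCylinders.lean` and the readable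
coordinates `shortStrings N` / `OracleVar N` of `OracleCircuitLocality.lean`,
`OraclePolynomialMethod.lean`). In print:

* Zhandry, CRYPTO 2012, **Thm. 3.1**: "Let `A` be a quantum algorithm making `q` quantum queries
  to an oracle `H : X → Y`. If we draw `H` from some weight assignment `D`, then for every `z`, the
  quantity `Pr_{H←D}[A^H() = z]` is a linear combination of the quantities
  `Pr_{H←D}[H(xᵢ) = rᵢ ∀ i ∈ {1, …, 2q}]` for all possible settings of the `xᵢ` and `rᵢ`", with
  its first corollary (loc. cit.): "If two weight assignments `D₁` and `D₂` are `2q`-wise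
  equivalent, then any `q` query quantum algorithm behaves the same under both";
* Yamakawa–Zhandry 2022, **Lemma 2.5** (citing the above): for any `q`-quantum-query algorithm,
  `Pr[A^H = 1 : H ← Func(X, Y)] = Pr[A^H = 1 : H ← F]` for every `2q`-wise independent family `F`.

Tree rendering (everything PROVED; the proof is the polynomial method, as in print — Zhandry's
Appendix B expands the density matrix entrywise, Beals et al. Lemma 4.2 does the same for the
acceptance probability):

* `allMem U` — the conjunction event "every string of `U` is in the oracle" (`U` a finite set of
  oracle variables), `= oracleCylinder (U.map val) (all true)`, of random-oracle measure `2^{-|U|}`;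
  `allMemInd U` its indicator;
* `exists_eval_oraclePt_eq_sum` — on oracles (0/1 points) a real polynomial of total degree `≤ k`
  in the oracle bits is a linear combination `∑_U c_U · 1[allMem U]` with `c_U = 0` for `|U| > k`
  (multilinear reduction `xᵢ^e = xᵢ`);
* **`exists_acceptProb_eq_sum_allMemInd`** (Thm. 3.1 in tree language) — for a circuit `C` with
  `T` oracle gates, `A ↦ Pr[C^A(x) accepts]` is such a combination with `|U| ≤ 2T`, hence
  (`integral_acceptProb_eq_sum`) for EVERY finite measure `μ` on oracles,
  `∫ Pr[C^A(x) accepts] dμ(A) = ∑_U c_U · μ(allMem U)`, coefficients independent of `μ`;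
* `KWiseEquivOn μ₁ μ₂ S k` (Zhandry's "`k`-wise equivalent", on the coordinates `S`),
  `IsKWiseUniformOn μ S k` (`k`-wise independent with uniform marginals = `k`-wise equivalent to
  the random oracle, `isKWiseUniformOn_iff_kWiseEquivOn`), `IsKWiseIndepFamily H S k` (a finite
  family of oracles `H : K → Set (List Bool)` under a uniform key, counting form as in
  `Cryptography.LeftoverHash.IsPairwiseIndep`);
* **`integral_acceptProb_eq_of_kWiseEquivOn`** (Thm. 3.1, first corollary),
  **`integral_acceptProb_eq_of_isKWiseUniformOn`** / `integral_acceptProbOn_eq_of_isKWiseUniformOn`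
  (measure form of Yamakawa–Zhandry Lemma 2.5: a `2T`-wise uniform law of oracles gives every
  `≤ T`-query circuit its random-oracle acceptance probability) and
  **`sum_acceptProb_eq_of_isKWiseIndepFamily`** (family form: the average over the keys of a
  `2T`-wise independent family equals the random-oracle average).

Not here: the construction of explicit `k`-wise independent families (random polynomials of degree
`< k` over `GF(2^m)`, Vandermonde) and their circuit complexity; Zhandry's Thm. 3.2 / semi-constant
distributions.

## References

* M. Zhandry, *Secure identity-based encryption in the quantum random oracle model*, CRYPTO 2012,
  LNCS 7417, 758–775, Thm. 3.1 and the two bullets following it (§3) [Zhandry2012IBE]; full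
  version Int. J. Quantum Inf. 13 (2015) 1550014, same numbering, proof in App. B (read)
  [Zhandry2015IBE].
* T. Yamakawa, M. Zhandry, *Verifiable quantum advantage without structure*, FOCS 2022,
  arXiv:2204.02063, Lemma 2.5 (p. 10) and its use in Lemma 6.11 [YamakawaZhandry2022FOCS].
* R. Beals, H. Buhrman, R. Cleve, M. Mosca, R. de Wolf, *Quantum lower bounds by polynomials*,
  J. ACM 48 (2001), Lemma 4.2 (via `exists_acceptPolynomial_circuit`) [BealsEtAl2001].
-/

noncomputable section

namespace Literature.Computability.QuantumComplexity

open _root_.MeasureTheory Finset Literature.Computability.Cryptography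
open scoped ENNReal

variable {G : QGateSet} {N n m : ℕ}

/-! ### Conjunction events over finitely many oracle variables -/

/-- The event "every string of `U` belongs to the oracle `A`" — Zhandry's
`Pr[H(xᵢ) = rᵢ ∀ i]` with all `rᵢ = 1`, for a finite set `U` of oracle variables (strings of
length `< N`). [cite: Zhandry2012IBE, Thm. 3.1] -/
def allMem (U : Finset (OracleVar N)) : Set (Set (List Bool)) :=
  {A | ∀ v ∈ U, (v : List Bool) ∈ A}

/-- Unfolding lemma for `allMem`. [folklore] -/
theorem mem_allMem_iff {U : Finset (OracleVar N)} {A : Set (List Bool)} :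
    A ∈ allMem U ↔ ∀ v ∈ U, (v : List Bool) ∈ A :=
  Iff.rfl

/-- The strings of a set of oracle variables are short strings. [folklore] -/
theorem map_subtype_subset_shortStrings (U : Finset (OracleVar N)) :
    U.map (Function.Embedding.subtype _) ⊆ shortStrings N := by
  intro u hu
  obtain ⟨v, -, rfl⟩ := Finset.mem_map.1 hu
  exact v.2

/-- `allMem U` is the all-`true` cylinder over the strings of `U`. [folklore] -/
theorem allMem_eq_oracleCylinder (U : Finset (OracleVar N)) :
    allMem U = oracleCylinder (U.map (Function.Embedding.subtype _)) fun _ => true := by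
  ext A
  simp only [mem_allMem_iff, mem_oracleCylinder_iff, funext_iff, restrictBool_eq_true_iff]
  constructor
  · rintro h ⟨u, hu⟩
    obtain ⟨v, hv, rfl⟩ := Finset.mem_map.1 hu
    exact h v hv
  · intro h v hv
    exact h ⟨v, Finset.mem_map_of_mem _ hv⟩

/-- `allMem U` is measurable. [folklore] -/
theorem measurableSet_allMem (U : Finset (OracleVar N)) : MeasurableSet (allMem U) := by
  rw [allMem_eq_oracleCylinder]
  exact measurableSet_oracleCylinder _ _

/-- Under the random oracle, all strings of `U` are in the oracle with probability `2^{-|U|}`. [folklore] -/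
theorem randomOracleMeasure_allMem (U : Finset (OracleVar N)) :
    randomOracleMeasure (allMem U) = 2⁻¹ ^ U.card := by
  rw [allMem_eq_oracleCylinder, measure_oracleCylinder, Finset.card_map]

/-- The same in `ℝ`: `randomOracleMeasure.real (allMem U) = 2^{-|U|}`. [folklore] -/
theorem randomOracleMeasure_real_allMem (U : Finset (OracleVar N)) :
    randomOracleMeasure.real (allMem U) = 2⁻¹ ^ U.card := by
  rw [measureReal_def, randomOracleMeasure_allMem]
  simp

/-- The indicator `1[allMem U]` — on oracles, the multilinear monomial `∏_{v ∈ U} [v ∈ A]`. [folklore] -/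
def allMemInd (U : Finset (OracleVar N)) : Set (List Bool) → ℝ :=
  (allMem U).indicator fun _ => 1

/-- Unfolding lemma for `allMemInd`. [folklore] -/
theorem allMemInd_apply (U : Finset (OracleVar N)) (A : Set (List Bool)) [Decidable (A ∈ allMem U)] :
    allMemInd U A = if A ∈ allMem U then 1 else 0 := by
  unfold allMemInd
  rw [Set.indicator_apply]

/-- `allMemInd U` is integrable for every finite measure on oracles. [folklore] -/
theorem integrable_allMemInd (μ : Measure (Set (List Bool))) [IsFiniteMeasure μ]
    (U : Finset (OracleVar N)) : Integrable (allMemInd U) μ :=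
  (integrable_const (1 : ℝ)).indicator (measurableSet_allMem U)

/-- `∫ 1[allMem U] dμ = μ (allMem U)`. [folklore] -/
theorem integral_allMemInd (μ : Measure (Set (List Bool))) (U : Finset (OracleVar N)) :
    ∫ A, allMemInd U A ∂μ = μ.real (allMem U) := by
  unfold allMemInd
  rw [integral_indicator_const (1 : ℝ) (measurableSet_allMem U), smul_eq_mul, mul_one]

/-- Linear combinations of the indicators integrate termwise:
`∫ ∑_U c_U 1[allMem U] dμ = ∑_U c_U μ(allMem U)`. [folklore] -/
theorem integral_sum_allMemInd (c : Finset (OracleVar N) → ℝ) (μ : Measure (Set (List Bool)))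
    [IsFiniteMeasure μ] :
    ∫ A, ∑ U, c U * allMemInd U A ∂μ = ∑ U, c U * μ.real (allMem U) := by
  rw [integral_finsetSum _ fun U _ => (integrable_allMemInd μ U).const_mul (c U)]
  refine Finset.sum_congr rfl fun U _ => ?_
  rw [integral_const_mul, integral_allMemInd]

/-! ### Multilinear reduction: low-degree polynomials in the oracle bits -/

/-- On an oracle (a `0/1` point) a monomial is the indicator of "all its variables are in the
oracle": `∏_{v ∈ supp d} [v ∈ A]^{d v} = 1[allMem (supp d)]` (`x^e = x` for `x ∈ {0,1}`,
`e ≥ 1`). [cite: BealsEtAl2001, Lemma 4.2 (multilinearity)] -/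
theorem prod_oraclePt_pow_eq_allMemInd (d : OracleVar N →₀ ℕ) (A : Set (List Bool)) :
    ∏ v ∈ d.support, oraclePt N A v ^ d v = allMemInd d.support A := by
  classical
  have h : ∀ v ∈ d.support, oraclePt N A v ^ d v = if (v : List Bool) ∈ A then (1 : ℝ) else 0 := by
    intro v hv
    have hd : d v ≠ 0 := Finsupp.mem_support_iff.1 hv
    by_cases hA : (v : List Bool) ∈ A
    · have hb : Set.boolIndicator A v.1 = true := (Set.mem_iff_boolIndicator (s := A) v.1).1 hA
      simp [oraclePt, hb, hA]
    · have hb : Set.boolIndicator A v.1 = false := (Set.notMem_iff_boolIndicator (s := A) v.1).1 hA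
      simp [oraclePt, hb, hA, hd]
  rw [Finset.prod_congr rfl h, Finset.prod_boole]
  by_cases hA : A ∈ allMem d.support
  · rw [if_pos (mem_allMem_iff.1 hA)]
    simp [allMemInd, hA]
  · rw [if_neg (mt mem_allMem_iff.2 hA)]
    simp [allMemInd, hA]

/-- The support of a monomial has at most `degree` elements. [folklore] -/
theorem card_support_le_sum (d : OracleVar N →₀ ℕ) : d.support.card ≤ d.sum fun _ e => e := by
  rw [Finsupp.sum, Finset.card_eq_sum_ones]
  exact Finset.sum_le_sum fun v hv => Nat.one_le_iff_ne_zero.mpr (Finsupp.mem_support_iff.mp hv)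

/-- **Multilinear reduction.** On oracles, a real polynomial of total degree `≤ k` in the oracle
bits is a linear combination `∑_U c_U · 1[allMem U]` over sets `U` of at most `k` oracle variables
(`c_U = 0` when `|U| > k`): group the monomials by their support. [cite: BealsEtAl2001, Lemma 4.2 (multilinear polynomial of degree ≤ 2T)] -/
theorem exists_eval_oraclePt_eq_sum (P : MvPolynomial (OracleVar N) ℝ) {k : ℕ} (hP : P.totalDegree ≤ k) :
    ∃ c : Finset (OracleVar N) → ℝ, (∀ U, k < U.card → c U = 0) ∧
      ∀ A : Set (List Bool), MvPolynomial.eval (oraclePt N A) P = ∑ U, c U * allMemInd U A := by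
  classical
  refine ⟨fun U => ∑ d ∈ P.support with d.support = U, P.coeff d, fun U hU => ?_, fun A => ?_⟩
  · refine Finset.sum_eq_zero fun d hd => ?_
    exfalso
    obtain ⟨hdP, hdU⟩ := Finset.mem_filter.1 hd
    have h1 := card_support_le_sum d
    have h2 := MvPolynomial.le_totalDegree hdP
    rw [hdU] at h1
    omega
  · rw [MvPolynomial.eval_eq]
    symm
    calc ∑ U, (∑ d ∈ P.support with d.support = U, P.coeff d) * allMemInd U A
        = ∑ U, ∑ d ∈ P.support with d.support = U, P.coeff d * allMemInd d.support A := by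
          refine Finset.sum_congr rfl fun U _ => ?_
          rw [Finset.sum_mul]
          refine Finset.sum_congr rfl fun d hd => ?_
          rw [(Finset.mem_filter.1 hd).2]
      _ = ∑ d ∈ P.support, P.coeff d * allMemInd d.support A :=
          Finset.sum_fiberwise P.support (fun d => d.support) _
      _ = ∑ d ∈ P.support, P.coeff d * ∏ v ∈ d.support, oraclePt N A v ^ d v :=
          Finset.sum_congr rfl fun d _ => by rw [prod_oraclePt_pow_eq_allMemInd]

/-! ### `k`-wise equivalence, `k`-wise uniformity, `k`-wise independent families -/

/-- Zhandry's **`k`-wise equivalence** of two weight assignments (here: measures on oracles),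
relative to the finite set `S` of coordinates: every cylinder prescribing at most `k` oracle bits
inside `S` has the same mass under both ("for all `W ⊆ X` of size `k`, the marginal weight
assignments `D₁,W` and `D₂,W` are identical"; prescribing fewer than `k` bits is included, which for
probability measures follows from the printed form by summing out). [cite: Zhandry2012IBE, §2.1 (k-wise equivalent weight assignments)] -/
def KWiseEquivOn (μ₁ μ₂ : Measure (Set (List Bool))) (S : Finset (List Bool)) (k : ℕ) : Prop :=
  ∀ U : Finset (List Bool), U ⊆ S → U.card ≤ k → ∀ τ : U → Bool,
    μ₁ (oracleCylinder U τ) = μ₂ (oracleCylinder U τ)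

/-- **`k`-wise uniformity** (`k`-wise independence with uniform marginals) of a law `μ` of oracles
on the coordinates `S`: every cylinder prescribing at most `k` oracle bits inside `S` has its
uniform mass `2^{-|U|}` — the law of `H ← F` for a "`k`-wise independent family of hash functions"
with one-bit outputs. [cite: YamakawaZhandry2022FOCS, Lemma 2.5 (2q-wise independent family)] -/
def IsKWiseUniformOn (μ : Measure (Set (List Bool))) (S : Finset (List Bool)) (k : ℕ) : Prop :=
  ∀ U : Finset (List Bool), U ⊆ S → U.card ≤ k → ∀ τ : U → Bool,
    μ (oracleCylinder U τ) = 2⁻¹ ^ U.card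

/-- A **`k`-wise independent family of oracles** `H : K → Set (List Bool)` on the coordinates `S`
(uniform key): for every `U ⊆ S` with `|U| ≤ k` and every bit pattern `τ` on `U`, exactly
`|K| / 2^{|U|}` keys realise `τ` (stated multiplied out, as `LeftoverHash.IsPairwiseIndep`).
[cite: YamakawaZhandry2022FOCS, Lemma 2.5 (2q-wise independent hash functions)] -/
def IsKWiseIndepFamily {K : Type*} [Fintype K] (H : K → Set (List Bool)) (S : Finset (List Bool))
    (k : ℕ) : Prop :=
  open scoped Classical in
  ∀ U : Finset (List Bool), U ⊆ S → U.card ≤ k → ∀ τ : U → Bool,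
    (Finset.univ.filter fun key => restrictBool U (H key) = τ).card * 2 ^ U.card = Fintype.card K

/-- The empty cylinder is everything. [folklore] -/
theorem oracleCylinder_empty (τ : ((∅ : Finset (List Bool)) : Finset (List Bool)) → Bool) :
    oracleCylinder ∅ τ = Set.univ := by
  ext A
  simp only [mem_oracleCylinder_iff, Set.mem_univ, iff_true]
  funext u
  exact absurd u.2 (Finset.notMem_empty _)

/-- The random oracle is `k`-wise uniform on every coordinate set, for every `k`. [folklore] -/
theorem isKWiseUniformOn_randomOracleMeasure (S : Finset (List Bool)) (k : ℕ) :
    IsKWiseUniformOn randomOracleMeasure S k :=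
  fun U _ _ τ => measure_oracleCylinder U τ

/-- `k`-wise uniform = `k`-wise equivalent to the random oracle. [folklore] -/
theorem isKWiseUniformOn_iff_kWiseEquivOn {μ : Measure (Set (List Bool))} {S : Finset (List Bool)} {k : ℕ} :
    IsKWiseUniformOn μ S k ↔ KWiseEquivOn μ randomOracleMeasure S k := by
  refine forall_congr' fun U => forall_congr' fun hU => forall_congr' fun hk => forall_congr' fun τ => ?_
  rw [measure_oracleCylinder]

/-- `k`-wise equivalence is symmetric. [folklore] -/
theorem KWiseEquivOn.symm {μ₁ μ₂ : Measure (Set (List Bool))} {S : Finset (List Bool)} {k : ℕ}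
    (h : KWiseEquivOn μ₁ μ₂ S k) : KWiseEquivOn μ₂ μ₁ S k :=
  fun U hU hk τ => (h U hU hk τ).symm

/-- `k`-wise equivalence is monotone: fewer coordinates, smaller `k`. [folklore] -/
theorem KWiseEquivOn.mono {μ₁ μ₂ : Measure (Set (List Bool))} {S S' : Finset (List Bool)} {k k' : ℕ}
    (h : KWiseEquivOn μ₁ μ₂ S k) (hS : S' ⊆ S) (hk : k' ≤ k) : KWiseEquivOn μ₁ μ₂ S' k' :=
  fun U hU hU' τ => h U (hU.trans hS) (hU'.trans hk) τ

/-- `k`-wise uniformity is monotone: fewer coordinates, smaller `k`. [folklore] -/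
theorem IsKWiseUniformOn.mono {μ : Measure (Set (List Bool))} {S S' : Finset (List Bool)} {k k' : ℕ}
    (h : IsKWiseUniformOn μ S k) (hS : S' ⊆ S) (hk : k' ≤ k) : IsKWiseUniformOn μ S' k' :=
  fun U hU hU' τ => h U (hU.trans hS) (hU'.trans hk) τ

/-- A `k`-wise uniform law is a probability measure (take `U = ∅`). [folklore] -/
theorem IsKWiseUniformOn.measure_univ {μ : Measure (Set (List Bool))} {S : Finset (List Bool)} {k : ℕ}
    (h : IsKWiseUniformOn μ S k) : μ Set.univ = 1 := by
  have := h ∅ (Finset.empty_subset _) (Nat.zero_le _) fun _ => true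
  rwa [oracleCylinder_empty, Finset.card_empty, pow_zero] at this

/-- A `k`-wise uniform law is a probability measure. [folklore] -/
theorem IsKWiseUniformOn.isProbabilityMeasure {μ : Measure (Set (List Bool))} {S : Finset (List Bool)}
    {k : ℕ} (h : IsKWiseUniformOn μ S k) : IsProbabilityMeasure μ :=
  ⟨h.measure_univ⟩

/-- `k`-wise equivalent laws (on the short strings) agree on the conjunction events of at most `k`
oracle variables. [folklore] -/
theorem KWiseEquivOn.measure_allMem {μ₁ μ₂ : Measure (Set (List Bool))} {k : ℕ}
    (h : KWiseEquivOn μ₁ μ₂ (shortStrings N) k) (U : Finset (OracleVar N)) (hU : U.card ≤ k) :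
    μ₁ (allMem U) = μ₂ (allMem U) := by
  rw [allMem_eq_oracleCylinder]
  exact h _ (map_subtype_subset_shortStrings U) (by rw [Finset.card_map]; exact hU) _

/-- A `k`-wise uniform law gives the conjunction of at most `k` oracle variables its uniform mass
`2^{-|U|}`. [folklore] -/
theorem IsKWiseUniformOn.measure_allMem {μ : Measure (Set (List Bool))} {k : ℕ}
    (h : IsKWiseUniformOn μ (shortStrings N) k) (U : Finset (OracleVar N)) (hU : U.card ≤ k) :
    μ (allMem U) = 2⁻¹ ^ U.card := by
  rw [(isKWiseUniformOn_iff_kWiseEquivOn.1 h).measure_allMem U hU, randomOracleMeasure_allMem]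

/-- In a `k`-wise independent family, the conjunction of at most `k` oracle variables holds for
exactly a `2^{-|U|}` fraction of the keys: `∑_key 1[allMem U](H key) = |K| · 2^{-|U|}`. [folklore] -/
theorem IsKWiseIndepFamily.sum_allMemInd {K : Type*} [Fintype K] {H : K → Set (List Bool)} {k : ℕ}
    (h : IsKWiseIndepFamily H (shortStrings N) k) (U : Finset (OracleVar N)) (hU : U.card ≤ k) :
    ∑ key, allMemInd U (H key) = Fintype.card K * 2⁻¹ ^ U.card := by
  classical
  have hK := h (U.map (Function.Embedding.subtype _)) (map_subtype_subset_shortStrings U)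
    (by rw [Finset.card_map]; exact hU) fun _ => true
  rw [Finset.card_map] at hK
  have hfilter : (Finset.univ.filter fun key => restrictBool (U.map (Function.Embedding.subtype _)) (H key) =
      fun _ => true) = Finset.univ.filter fun key => H key ∈ allMem U := by
    refine Finset.filter_congr fun key _ => ?_
    rw [allMem_eq_oracleCylinder, mem_oracleCylinder_iff]
  have hsum : ∑ key, allMemInd U (H key) = ((Finset.univ.filter fun key => H key ∈ allMem U).card : ℝ) := by
    rw [← Finset.sum_boole]
    exact Finset.sum_congr rfl fun key _ => allMemInd_apply U (H key)
  have hK' : ((Finset.univ.filter fun key => H key ∈ allMem U).card : ℝ) * 2 ^ U.card = Fintype.card K := by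
    rw [← hfilter]
    exact_mod_cast hK
  rw [hsum, ← hK', inv_pow, mul_inv_cancel_right₀ (pow_ne_zero _ two_ne_zero)]

/-! ### Zhandry's theorem for oracle circuits -/

/-- **Zhandry 2012, Thm. 3.1, in tree language.** For a circuit `C` on `n + m` wires with `T`
oracle gates and an input `x`, the acceptance probability `A ↦ Pr[C^A(x) accepts]` is a linear
combination `∑_U c_U · 1[every string of U is in A]` over sets `U` of AT MOST `2T` oracle variables
(strings of length `< n + m`), with coefficients `c_U` not depending on the oracle (`c_U = 0` for
`|U| > 2T`). Printed form: "`Pr_{H←D}[A^H() = z]` is a linear combination of the quantities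
`Pr_{H←D}[H(xᵢ) = rᵢ ∀ i ∈ {1,…,2q}]`" — here with all `rᵢ = 1`, which suffices by
inclusion–exclusion; integrate against `D` (`integral_acceptProb_eq_sum`). [cite: Zhandry2012IBE, Thm. 3.1] -/
theorem exists_acceptProb_eq_sum_allMemInd (C : QCircuit G (n + m)) (x : QReg n) :
    ∃ c : Finset (OracleVar (n + m)) → ℝ, (∀ U, 2 * C.oracleQueries < U.card → c U = 0) ∧
      ∀ A : Set (List Bool), C.acceptProb A x = ∑ U, c U * allMemInd U A := by
  obtain ⟨P, hP, hPA⟩ := exists_acceptPolynomial_circuit C x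
  obtain ⟨c, hc, hcA⟩ := exists_eval_oraclePt_eq_sum P hP
  exact ⟨c, hc, fun A => (hPA A).trans (hcA A)⟩

/-- **Zhandry 2012, Thm. 3.1, integrated form**: for EVERY finite measure ("weight assignment")
`μ` on oracles, `∫ Pr[C^A(x) accepts] dμ(A) = ∑_U c_U · μ {A | U ⊆ A}` with the oracle-independent
coefficients `c_U` of `exists_acceptProb_eq_sum_allMemInd` (`c_U = 0` unless `|U| ≤ 2T`). [cite: Zhandry2012IBE, Thm. 3.1] -/
theorem integral_acceptProb_eq_sum (C : QCircuit G (n + m)) (x : QReg n) :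
    ∃ c : Finset (OracleVar (n + m)) → ℝ, (∀ U, 2 * C.oracleQueries < U.card → c U = 0) ∧
      ∀ (μ : Measure (Set (List Bool))) [IsFiniteMeasure μ],
        ∫ A, C.acceptProb A x ∂μ = ∑ U, c U * μ.real (allMem U) := by
  obtain ⟨c, hc, hcA⟩ := exists_acceptProb_eq_sum_allMemInd C x
  refine ⟨c, hc, fun μ _ => ?_⟩
  simp_rw [hcA]
  exact integral_sum_allMemInd c μ

/-- **Zhandry 2012, Thm. 3.1, first corollary ("`2q`-wise equivalent weight assignments are
indistinguishable by `q` quantum queries")**: if two finite measures on oracles are `2T`-wise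
equivalent on the strings of length `< n + m`, every circuit on `n + m` wires with at most `T`
oracle gates has the same expected acceptance probability under both. [cite: Zhandry2012IBE, Thm. 3.1 (first corollary, §3)] -/
theorem integral_acceptProb_eq_of_kWiseEquivOn (C : QCircuit G (n + m)) (x : QReg n)
    (μ₁ μ₂ : Measure (Set (List Bool))) [IsFiniteMeasure μ₁] [IsFiniteMeasure μ₂]
    (h : KWiseEquivOn μ₁ μ₂ (shortStrings (n + m)) (2 * C.oracleQueries)) :
    ∫ A, C.acceptProb A x ∂μ₁ = ∫ A, C.acceptProb A x ∂μ₂ := by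
  obtain ⟨c, hc, hcμ⟩ := integral_acceptProb_eq_sum C x
  rw [hcμ μ₁, hcμ μ₂]
  refine Finset.sum_congr rfl fun U _ => ?_
  by_cases hU : 2 * C.oracleQueries < U.card
  · rw [hc U hU, zero_mul, zero_mul]
  · rw [measureReal_def, measureReal_def, h.measure_allMem U (not_lt.1 hU)]

/-- **Yamakawa–Zhandry 2022, Lemma 2.5 (Zhandry's bounded-independence lemma), measure form.**
If the law `μ` of the oracle is `2T`-wise uniform on the strings of length `< n + m` (every
`≤ 2T` of those oracle bits are independent fair coins), then every circuit on `n + m` wires with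
at most `T` XOR-query oracle gates accepts `|x⟩|0^m⟩` with the same average probability as under
the random oracle: `∫ Pr[C^A(x) accepts] dμ = ∫ Pr[C^A(x) accepts] d(randomOracleMeasure)`.
(`μ` is automatically a probability measure, `IsKWiseUniformOn.isProbabilityMeasure`; for fewer
oracle gates use `IsKWiseUniformOn.mono`.) [cite: YamakawaZhandry2022FOCS, Lemma 2.5] -/
theorem integral_acceptProb_eq_of_isKWiseUniformOn (C : QCircuit G (n + m)) (x : QReg n)
    (μ : Measure (Set (List Bool))) (h : IsKWiseUniformOn μ (shortStrings (n + m)) (2 * C.oracleQueries)) :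
    ∫ A, C.acceptProb A x ∂μ = ∫ A, C.acceptProb A x ∂randomOracleMeasure := by
  haveI := h.isProbabilityMeasure
  exact integral_acceptProb_eq_of_kWiseEquivOn C x μ randomOracleMeasure
    (isKWiseUniformOn_iff_kWiseEquivOn.1 h)

/-- **Yamakawa–Zhandry 2022, Lemma 2.5, for circuit families** (`BQP^A`-type machines): on input
`x`, a family `F` whose circuit `F.circ |x|` has `T` oracle gates has the same average acceptance
probability under any law of oracles that is `2T`-wise uniform on the strings of length
`< |x| + ancillas |x|` as under the random oracle. [cite: YamakawaZhandry2022FOCS, Lemma 2.5] -/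
theorem integral_acceptProbOn_eq_of_isKWiseUniformOn (F : QCircuitFamily G) (x : List Bool)
    (μ : Measure (Set (List Bool)))
    (h : IsKWiseUniformOn μ (shortStrings (x.length + F.ancillas x.length))
      (2 * (F.circ x.length).oracleQueries)) :
    ∫ A, F.acceptProbOn A x ∂μ = ∫ A, F.acceptProbOn A x ∂randomOracleMeasure :=
  integral_acceptProb_eq_of_isKWiseUniformOn (F.circ x.length) x.get μ h

/-- **Yamakawa–Zhandry 2022, Lemma 2.5, family form** ("`Pr[A^H = 1 : H ← Func(X,Y)] =
Pr[A^H = 1 : H ← F]` for a `2q`-wise independent family `F`"): for a finite family of oracles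
`H : K → Set (List Bool)` which is `2T`-wise independent on the strings of length `< n + m`, the
average over the keys of the acceptance probability of a circuit with at most `T` oracle gates is
its random-oracle average: `∑_key Pr[C^{H key}(x) accepts] = |K| · ∫ Pr[C^A(x) accepts] d(randomOracleMeasure)`.
[cite: YamakawaZhandry2022FOCS, Lemma 2.5] -/
theorem sum_acceptProb_eq_of_isKWiseIndepFamily {K : Type*} [Fintype K] (H : K → Set (List Bool))
    (C : QCircuit G (n + m)) (x : QReg n)
    (hH : IsKWiseIndepFamily H (shortStrings (n + m)) (2 * C.oracleQueries)) :
    ∑ key, C.acceptProb (H key) x = Fintype.card K * ∫ A, C.acceptProb A x ∂randomOracleMeasure := by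
  obtain ⟨c, hc, hcA⟩ := exists_acceptProb_eq_sum_allMemInd C x
  simp_rw [hcA]
  rw [integral_sum_allMemInd, Finset.sum_comm, Finset.mul_sum]
  refine Finset.sum_congr rfl fun U _ => ?_
  rw [← Finset.mul_sum]
  by_cases hU : 2 * C.oracleQueries < U.card
  · rw [hc U hU, zero_mul, zero_mul, mul_zero]
  · rw [hH.sum_allMemInd U (not_lt.1 hU), randomOracleMeasure_real_allMem]
    ring

end Literature.Computability.QuantumComplexity

end
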